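import Literature.MathematicalPhysics.QuantumFieldTheory.Balaban1983to89.B1Eq230FluctCovPos
import Literature.MathematicalPhysics.QuantumFieldTheory.Balaban1983to89.B3Eq14AuxFunction

/-!
# `Balaban1983to89.B3ScalarPropagatorMean` — T. Bałaban, *(Higgs)₂,₃ quantum fields in a finite volume. III.
Renormalization*, Commun. Math. Phys. **88** (1983) 411–445 [Balaban1983Higgs3], Sect. 1 pp. 414–415: **«The basic
propagator for the scalar field φ′ is G_k(Ω, B̃)» and «The external scalar field is a_kG_k(Ω, B̃)Q_k(B̃)φ or (1.12)»** —
PROVED for the typed renormalization transformation of (1.4) (`B3Eq14AuxFunction.Data14.kernel14`, the kernel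
`t(Ω; φ, φ′)` of (I.2.5)/(I.2.10) at the external field `B̃ = A^{(k)}`, and the quadratic form
`½⟨φ′, (−Δ^η_{B̃,Ω} + m²(L^kε)²)φ′⟩` of its density): COMPLETING THE SQUARE in the old field `φ′` on the region
`Ω = B^k(Ω^{(k)})`, the Gaussian weight `t(Ω;φ,φ′)·exp(−½⟨φ′,(−Δ^η_{B̃,Ω}+m²(L^kε)²)φ′⟩)` is
`const · exp(−½⟨1_{Ω^{(k)}}φ, Δ^{(k)}(Ω,B̃) 1_{Ω^{(k)}}φ⟩) · exp(−½⟨φ′ − φ′₀, G_k(Ω,B̃)^{−1}(φ′ − φ′₀)⟩)` with the MEAN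
`φ′₀ = a_k(L^kη)^{−2} G_k(Ω,B̃) Q_k^*(B̃) (1_{Ω^{(k)}}φ)` (print's `a_kG_k(Ω,B̃)Q_k^*(B̃)φ`, `L^kη = 1`) supported in `Ω`, and
the COVARIANCE `G_k(Ω,B̃) = (−Δ^{η,N}_{B̃,Ω} + m²(L^kε)² + a_k(L^kη)^{−2}Q_k^*(B̃)Q_k(B̃))^{−1}` (`HiggsCovariance.propagatorK`,
(I.2.20)/(I.2.22)); theorems only

statement-level skeleton of published theorems with citation tags; proofs where landed; nothing here is a claim about the Yang–Mills mass gap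

PDFs held: `paper:balaban1983-higgs-2-3-quantum-fields-finite-volume` (journal page = PDF page + 410) and
`paper:balaban1982-cmp85-higgs23-i` (journal page = PDF page + 602).  Read on the ×2 renders
`run/shared/lean/pub/pub-balaban/b2b-balaban-ref1/pages/1983-cmp88-higgs23-III/1983-cmp88-higgs23-III-p004-x2.png` (p. 414),
`…-p005-x2.png` (p. 415), `…-p002-x2.png` (p. 412) and `…/1982-cmp85-higgs23-I/1982-cmp85-higgs23-I-p008-x2.png` (p. 610),
never from the OCR layer.

CITATION HEADER (lean-in-tree rule).  lit-balaban typed skeleton (HOME `run/shared/lean/pub/lit-balaban/`), typer line,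
companion of `B3Eq14AuxFunction` (the typed (1.4)) and `B3FluctFieldCovariance` (the vector-field half of the same p. 414
paragraph); located member of the SKELETON rows **B3.Eq1.12-1.15** (p. 414 «Next we have to describe propagators»),
**B3.Eq1.17-1.18** (p. 415, the sentence before the legend (1.17)) and **B3.Eq1.4** (owner r15; cells only).  THE SOURCE
TEXT, p. 414 [PDF 4], verbatim: *"The basic propagator for the scalar field φ′ is G_k(Ω, B̃), but there are other propagators
also."*; p. 415 [PDF 5], verbatim: *"Of course the whole expression is multiplied by a proper combinatorial factor connected
with the number of ways given expression can be obtained from Gaussian integrals in (1.5). The external scalar field is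
a_kG_k(Ω, B̃)Q_k(B̃)φ or (1.12), but we can easily add the field G_k(Ω, B̃)f coming from external sources in the generating
functional for Schwinger functions."* ⟦reading: `Q_k(B̃)φ` in this sentence is print's shorthand for `Q_k^*(B̃)φ` — `φ` is
the NEW field on the `L^kη`-lattice and `G_k(Ω,B̃)` acts on `η`-lattice fields, so the adjoint (I.2.20) is meant, as in
paper I (3.29) *"φ^{(k),ε} = a_k(L^kε)^{−2}G^ε_k(A^{(k),ε})Q^*_k(A^{(k),ε})φ"*; the kernel theorem below exhibits the `Q_k^*`⟧;
paper I p. 610 [PDF 8]: *"Defining the propagator G^ε_k(Ω,A) = (−Δ^{ε,N}_{A,Ω} + m² + a_k(L^kε)^{−2}P_k(A))^{−1}, P_k(A) =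
Q^*_k(A)Q_k(A), (2.20) and calculating the integral in (2.19), we obtain ⟨ψ,Δ^{(k),L^kε}(Ω,A)ψ⟩ = a_k(L^kε)^{−2}⟨ψ,ψ⟩ −
a_k²(L^kε)^{−4}⟨ψ,Q_k(A)G^ε_k(Ω,A)Q^*_k(A)ψ⟩. (2.21)"* and *"the rescaled propagator is given by G_k(Ω,A) = (−Δ^{η,N}_{A,Ω} +
m²(L^kε)² + a_kP_k(A))^{−1}. (2.22)"*.

WHAT IS PROVED (0 sorry; theorems only; nothing re-declared — `Data14.kernel14/scalarOp/Ω`, `HiggsCovariance.covOpK/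
propagatorK/avgQkLin/avgQkAdj/covLaplacianN`, `B1Eq230FluctCov.deltaKA`, `HiggsFluctMeasure.coeff221`, `B1RT.prec/rtKernel`
consumed BY NAME; scalar products (I.1.5) `HiggsLattice.siteInner`).  For a coupling `C`, a block-lattice region
`Ω^{(k)} ⊂ T^{(k)}` with `Ω = B^k(Ω^{(k)})` (`B3Eq14AuxFunction.region`), an external field `B̃` on the `η`-lattice, masses
`msq > 0` (↤ `m²(L^kε)²`) and `a` with `a_k ≥ 0`:
* §1 SUPPORT: fields on `Ω` stay on `Ω` — `Q_k(B̃)φ′` vanishes off `Ω^{(k)}` for `φ′` supported in `Ω` (`avgQkLin_apply_eq_zero_of_not_mem`),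
  the Neumann operator `−Δ^{η,N}_{B̃,Ω}` takes values supported in `Ω` (`covLaplacianN_apply_of_not_mem`) and kills fields supported
  off `Ω` (`covLaplacianN_eq_zero_of_compl`), hence `G_k(Ω,B̃)^{−1}` (`covOpK`) preserves both supports and **`G_k(Ω,B̃)` maps fields
  supported in `Ω` to fields supported in `Ω`** (`propagatorK_apply_of_not_mem`);
* §2 COMPLETING THE SQUARE (the computation behind *"calculating the integral in (2.19)"*, here for the typed B3 objects at a
  general region and background): for every new field `φ` and every old field `φ′` supported in `Ω`,
  `a_k(L^kη)^{d−2} Σ_{y∈Ω^{(k)}} |φ(y) − (Q_k(B̃)φ′)(y)|² + ⟨φ′, (−Δ^{η,N}_{B̃,Ω} + msq)φ′⟩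
   = ⟨1φ, Δ^{(k)}(Ω,B̃) 1φ⟩ + ⟨φ′ − φ′₀, G_k(Ω,B̃)^{−1}(φ′ − φ′₀)⟩`, `φ′₀ = a_k(L^kη)^{−2}G_k(Ω,B̃)Q_k^*(B̃)(1φ)`, `1φ = 1_{Ω^{(k)}}φ`
  (`exponent_eq_completed_square`; the constant identified with p35's `deltaKA` = (I.2.21), `const_eq_siteInner_deltaKA`);
* §3 FOR THE TYPED (1.4): the Gaussian weight of `Data14` at `e′ = 0` factorises accordingly (`kernel14_mul_exp_eq`), the mean
  `φ′₀` is supported in `Ω` (`mean_apply_of_not_mem`, `extendZero_mean`), and — the form in which print USES the two sentences,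
  *"obtained from Gaussian integrals in (1.5)"* — the typed transformation `Data14.rt14` applied to the Gaussian density times any
  observable `F` is `const(φ)·∫dχ↾Ω e^{−½⟨χ,G_k(Ω,A^{(k)})^{−1}χ⟩}F(φ′₀ + χ)` after the translation `φ′ = φ′₀ + χ`
  (**`rt14_gaussian_eq`**, translation invariance of `∫dφ′↾Ω`): print's *"The external scalar field is a_kG_k(Ω, B̃)Q_k(B̃)φ"* (the
  mean; `Q_k^*` exhibited) and *"The basic propagator for the scalar field φ′ is G_k(Ω, B̃)"* (the covariance of the fluctuation
  `χ`) as kernel facts about the typed (1.4).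
HONEST SCOPE.  (a) The normalisation of the `χ`-Gaussian (its total mass, a determinant) is not computed here (p15's
`B1Eq239Normalization` / p34's `B1Eq221Dictionary` pattern); the statements hold for every observable `F` with both sides the
same Bochner value.  (b) The quartic, mass-counterterm and `E₁` terms of the density (1.4) are print's vertices (1.6), (1.7) and
constants and are not part of the Gaussian weight.  (c) `G_k(Ω,B̃)` is the typer's operator on all fields of `T_η` (bonds outside
`Ω` dropped, `P_k` on all blocks); §1 shows it restricts to print's operator on the fields on `Ω`.  Unit `lit-balaban-typer`
gen 30 (literature-prover-lit-balaban-typer-g30-0); HOME/FILED.md records the proposal.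
-/

open scoped BigOperators InnerProductSpace
open _root_.MeasureTheory

namespace Literature.MathematicalPhysics.QuantumFieldTheory.Balaban1983to89.B3ScalarPropagatorMean

open Literature.MathematicalPhysics.QuantumFieldTheory.Balaban1983to89.HiggsLattice
open Literature.MathematicalPhysics.QuantumFieldTheory.Balaban1983to89.HiggsAveraging
open Literature.MathematicalPhysics.QuantumFieldTheory.Balaban1983to89.HiggsCovariance
open Literature.MathematicalPhysics.QuantumFieldTheory.Balaban1983to89.HiggsCovariancePos
open Literature.MathematicalPhysics.QuantumFieldTheory.Balaban1983to89.HiggsCovarianceCont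
open Literature.MathematicalPhysics.QuantumFieldTheory.Balaban1983to89.HiggsFluctMeasure
open Literature.MathematicalPhysics.QuantumFieldTheory.Balaban1983to89.HiggsFluctMeasurePos
open Literature.MathematicalPhysics.QuantumFieldTheory.Balaban1983to89.B1Eq230FluctCov
open Literature.MathematicalPhysics.QuantumFieldTheory.Balaban1983to89.B1Eq230FluctCovPos
open Literature.MathematicalPhysics.QuantumFieldTheory.Balaban1983to89.B3Eq14AuxFunction
open Literature.MathematicalPhysics.QuantumFieldTheory.Balaban1983to89.B1RT

variable {P : HiggsLattice.Params} {N : ℕ}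

/-! ## 1. Support: `Ω = B^k(Ω^{(k)})`-supported fields under `Q_k(B̃)`, `−Δ^{η,N}_{B̃,Ω}`, `G_k(Ω,B̃)^{±1}` -/

section Support

variable (C : ChargeData N) (A : HiggsLattice.VecField P 0) {k : ℕ} (Ωk : Finset (HiggsLattice.Site P k))

/-- `Q_k(B̃)φ′` vanishes off `Ω^{(k)}` when `φ′` is supported in `Ω = B^k(Ω^{(k)})` ((I.2.11): the average over `B^k(y)`,
`y ∉ Ω^{(k)}`, sees only sites outside `Ω`). [cite: Balaban1982Higgs1, (2.11) p.609] -/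
theorem avgQkLin_apply_eq_zero_of_not_mem {φ' : ScalarField P 0 N} (hφ' : ∀ x, x ∉ region k Ωk → φ' x = 0)
    {y : HiggsLattice.Site P k} (hy : y ∉ Ωk) : avgQkLin C A k φ' y = 0 := by
  rw [avgQkLin_apply, avgQk_apply]
  have h : ∑ x ∈ blockK k y, C.U (P.mesh 0) (multiContourSum A k x) (φ' x) = 0 := by
    refine Finset.sum_eq_zero fun x hx => ?_
    have hxy := (mem_blockK k y x).mp hx
    have hx' : x ∉ region k Ωk := fun h => hy (by rw [mem_region, hxy] at h; exact h)
    rw [hφ' x hx', map_zero]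
  rw [h, smul_zero]

/-- `Q_k(B̃)v` vanishes ON `Ω^{(k)}` when `v` is supported OFF `Ω`. [cite: Balaban1982Higgs1, (2.11) p.609] -/
theorem avgQkLin_apply_eq_zero_of_mem {v : ScalarField P 0 N} (hv : ∀ x, x ∈ region k Ωk → v x = 0)
    {y : HiggsLattice.Site P k} (hy : y ∈ Ωk) : avgQkLin C A k v y = 0 := by
  rw [avgQkLin_apply, avgQk_apply]
  have h : ∑ x ∈ blockK k y, C.U (P.mesh 0) (multiContourSum A k x) (v x) = 0 := by
    refine Finset.sum_eq_zero fun x hx => ?_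
    have hxy := (mem_blockK k y x).mp hx
    have hx' : x ∈ region k Ωk := by rw [mem_region, hxy]; exact hy
    rw [hv x hx', map_zero]
  rw [h, smul_zero]

/-- `P_k(B̃)φ′ = Q_k^*(B̃)Q_k(B̃)φ′` is supported in `Ω` when `φ′` is (`(Q_k^*ψ)(x) = U^*ψ(x_k)` and `x ∈ Ω ↔ x_k ∈ Ω^{(k)}`).
[cite: Balaban1982Higgs1, (2.20) p.610] -/
theorem projPk_apply_eq_zero_of_not_mem {φ' : ScalarField P 0 N} (hφ' : ∀ x, x ∉ region k Ωk → φ' x = 0)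
    {x : HiggsLattice.Site P 0} (hx : x ∉ region k Ωk) : avgQkAdj C A k (avgQkLin C A k φ') x = 0 := by
  rw [avgQkAdj_apply_eq, avgQkLin_apply_eq_zero_of_not_mem C A Ωk hφ' (by rwa [mem_region] at hx), map_zero]

/-- `P_k(B̃)v` is supported off `Ω` when `v` is. [cite: Balaban1982Higgs1, (2.20) p.610] -/
theorem projPk_apply_eq_zero_of_mem {v : ScalarField P 0 N} (hv : ∀ x, x ∈ region k Ωk → v x = 0)
    {x : HiggsLattice.Site P 0} (hx : x ∈ region k Ωk) : avgQkAdj C A k (avgQkLin C A k v) x = 0 := by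
  rw [avgQkAdj_apply_eq, avgQkLin_apply_eq_zero_of_mem C A Ωk hv (by rwa [mem_region] at hx), map_zero]

/-- The Neumann operator `−Δ^{η,N}_{B̃,Ω}` takes values supported in `Ω` (only bonds with both endpoints in `Ω` are kept,
(I.2.17)). [cite: Balaban1982Higgs1, (2.17) p.610] -/
theorem covLaplacianN_apply_of_not_mem (Ω : Finset (HiggsLattice.Site P 0)) (φ : ScalarField P 0 N)
    {x : HiggsLattice.Site P 0} (hx : x ∉ Ω) : covLaplacianN C Ω A φ x = 0 := by
  have happ : covLaplacianN C Ω A φ x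
      = ((P.mesh 0)⁻¹ ^ 2) • ∑ μ : Fin P.d, (fwdTerm C Ω A x μ φ + bwdTerm C Ω A x μ φ) := by
    simp only [covLaplacianN, LinearMap.pi_apply, LinearMap.smul_apply, LinearMap.coe_sum, Finset.sum_apply,
      LinearMap.add_apply]
  rw [happ]
  have h : ∑ μ : Fin P.d, (fwdTerm C Ω A x μ φ + bwdTerm C Ω A x μ φ) = 0 := by
    refine Finset.sum_eq_zero fun μ _ => ?_
    rw [fwdTerm_apply, bwdTerm_apply, if_neg (fun h => hx h.1), if_neg (fun h => hx h.1), add_zero]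
  rw [h, smul_zero]

/-- The Neumann operator kills fields supported off `Ω`: `−Δ^{η,N}_{B̃,Ω}v = 0` if `v = 0` on `Ω`. [cite: Balaban1982Higgs1, (2.17) p.610] -/
theorem covLaplacianN_eq_zero_of_compl (Ω : Finset (HiggsLattice.Site P 0)) {v : ScalarField P 0 N}
    (hv : ∀ x, x ∈ Ω → v x = 0) : covLaplacianN C Ω A v = 0 := by
  funext x
  have happ : covLaplacianN C Ω A v x
      = ((P.mesh 0)⁻¹ ^ 2) • ∑ μ : Fin P.d, (fwdTerm C Ω A x μ v + bwdTerm C Ω A x μ v) := by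
    simp only [covLaplacianN, LinearMap.pi_apply, LinearMap.smul_apply, LinearMap.coe_sum, Finset.sum_apply,
      LinearMap.add_apply]
  rw [happ, Pi.zero_apply]
  have h : ∑ μ : Fin P.d, (fwdTerm C Ω A x μ v + bwdTerm C Ω A x μ v) = 0 := by
    refine Finset.sum_eq_zero fun μ _ => ?_
    rw [fwdTerm_apply, bwdTerm_apply]
    split_ifs with h1 h2 h2
    · rw [hv x h1.1, hv _ h1.2, hv _ h2.2, map_zero, map_zero, sub_zero, add_zero]
    · rw [hv x h1.1, hv _ h1.2, map_zero, sub_zero, add_zero]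
    · rw [hv x h2.1, hv _ h2.2, map_zero, sub_zero, zero_add]
    · rw [add_zero]
  rw [h, smul_zero]

variable (msq a : ℝ)

/-- `G_k(Ω,B̃)^{−1} = −Δ^{η,N}_{B̃,Ω} + msq + a_k(L^kη)^{−2}P_k(B̃)` (`covOpK`) maps fields supported in `Ω` to fields supported
in `Ω`. [cite: Balaban1982Higgs1, (2.20) p.610] -/
theorem covOpK_apply_eq_zero_of_not_mem {φ' : ScalarField P 0 N} (hφ' : ∀ x, x ∉ region k Ωk → φ' x = 0)
    {x : HiggsLattice.Site P 0} (hx : x ∉ region k Ωk) : covOpK C (region k Ωk) A msq a k φ' x = 0 := by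
  rw [covOpK_eq_coeff221, LinearMap.add_apply, LinearMap.add_apply, LinearMap.smul_apply, LinearMap.smul_apply,
    LinearMap.id_apply, LinearMap.comp_apply, Pi.add_apply, Pi.add_apply, Pi.smul_apply, Pi.smul_apply,
    covLaplacianN_apply_of_not_mem C A _ φ' hx, hφ' x hx, projPk_apply_eq_zero_of_not_mem C A Ωk hφ' hx,
    smul_zero, smul_zero, add_zero, add_zero]

/-- `G_k(Ω,B̃)^{−1}` maps fields supported off `Ω` to fields supported off `Ω` (on such fields it is
`msq + a_k(L^kη)^{−2}P_k(B̃)`, block-diagonal). [cite: Balaban1982Higgs1, (2.20) p.610] -/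
theorem covOpK_apply_eq_zero_of_mem {v : ScalarField P 0 N} (hv : ∀ x, x ∈ region k Ωk → v x = 0)
    {x : HiggsLattice.Site P 0} (hx : x ∈ region k Ωk) : covOpK C (region k Ωk) A msq a k v x = 0 := by
  rw [covOpK_eq_coeff221, LinearMap.add_apply, LinearMap.add_apply, LinearMap.smul_apply, LinearMap.smul_apply,
    LinearMap.id_apply, LinearMap.comp_apply, Pi.add_apply, Pi.add_apply, Pi.smul_apply, Pi.smul_apply,
    covLaplacianN_eq_zero_of_compl C A _ hv, Pi.zero_apply, hv x hx, projPk_apply_eq_zero_of_mem C A Ωk hv hx,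
    smul_zero, smul_zero, add_zero, add_zero]

/-- **`G_k(Ω,B̃)` maps fields supported in `Ω` to fields supported in `Ω`** (`msq > 0`, `a_k ≥ 0`, every `B̃`): the
typer's whole-torus operator restricts to print's propagator on the fields on `Ω`.  (Split `G_kb = u + v` along `Ω`;
`G_k^{−1}v` lives off `Ω` and equals `b − G_k^{−1}u`, which lives in `Ω`; so `G_k^{−1}v = 0` and `v = 0` by injectivity,
`HiggsCovariancePos.covOpK_injective`.) [cite: Balaban1983Higgs3, §1 p.414] -/
theorem propagatorK_apply_of_not_mem (hmsq : 0 < msq) (hak : 0 ≤ B1.aSeq a P.L k) {b : ScalarField P 0 N}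
    (hb : ∀ x, x ∉ region k Ωk → b x = 0) {x : HiggsLattice.Site P 0} (hx : x ∉ region k Ωk) :
    propagatorK C (region k Ωk) A msq a k b x = 0 := by
  classical
  set g := propagatorK C (region k Ωk) A msq a k b with hg
  set u : ScalarField P 0 N := fun x => if x ∈ region k Ωk then g x else 0 with hu
  set v : ScalarField P 0 N := fun x => if x ∈ region k Ωk then 0 else g x with hv
  have hguv : g = u + v := by
    funext y
    simp only [hu, hv, Pi.add_apply]
    split_ifs <;> simp
  have hu0 : ∀ y, y ∉ region k Ωk → u y = 0 := fun y hy => by simp [hu, hy]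
  have hv0 : ∀ y, y ∈ region k Ωk → v y = 0 := fun y hy => by simp [hv, hy]
  have hMg : covOpK C (region k Ωk) A msq a k g = b := by
    rw [hg, covOpK_propagatorK_apply C _ A hmsq a k hak]
  have hMv : covOpK C (region k Ωk) A msq a k v = 0 := by
    funext y
    by_cases hy : y ∈ region k Ωk
    · exact covOpK_apply_eq_zero_of_mem C A Ωk msq a hv0 hy
    · have h := congrFun hMg y
      rw [hguv, map_add, Pi.add_apply, covOpK_apply_eq_zero_of_not_mem C A Ωk msq a hu0 hy, zero_add, hb y hy] at h
      rw [h, Pi.zero_apply]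
  have hvz : v = 0 := covOpK_injective C _ A hmsq a k hak (by rw [hMv, map_zero])
  have hgx : g x = u x + v x := by rw [hguv]; rfl
  rw [hgx, hvz, Pi.zero_apply, add_zero, hu0 x hx]

end Support

/-! ## 2. Completing the square in the old field `φ′` on `Ω` -/

section Square

variable (C : ChargeData N) (A : HiggsLattice.VecField P 0) {k : ℕ} (Ωk : Finset (HiggsLattice.Site P k)) (msq a : ℝ)

/-- The kernel precision `a_k(L^kη)^{d−2}` of (I.2.10) is `a_k(L^kη)^{−2}·(L^kη)^d` — the coefficient of (I.2.21) times the
weight of the level-`k` scalar product (I.1.5). [cite: Balaban1982Higgs1, (2.10) p.609] -/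
theorem prec_eq_coeff221_mul (a : ℝ) (k : ℕ) :
    prec (B1.aSeq a P.L k) (P.mesh k) P.d = coeff221 P a k * P.mesh k ^ P.d := by
  have hℓ : P.mesh k ≠ 0 := (P.mesh_pos k).ne'
  rw [prec_eq, coeff221_eq, inv_pow, mul_assoc]
  congr 1
  rw [zpow_sub₀ hℓ, zpow_natCast, zpow_ofNat, div_eq_mul_inv, mul_comm]

/-- The φφ-term: `(L^kη)^d Σ_{y∈Ω^{(k)}} |φ(y) − (Q_kφ′)(y)|² = ⟨1φ − Q_kφ′, 1φ − Q_kφ′⟩_{L^kη}` for `φ′` supported in `Ω`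
(`Q_kφ′ = 0` off `Ω^{(k)}`), `1φ := 1_{Ω^{(k)}}φ`. [cite: Balaban1982Higgs1, (2.10) p.609] -/
theorem mesh_pow_mul_sum_eq_siteInner (φ : ScalarField P k N) {φ' : ScalarField P 0 N}
    (hφ' : ∀ x, x ∉ region k Ωk → φ' x = 0) :
    P.mesh k ^ P.d * ∑ y ∈ Ωk, ‖φ y - avgQkLin C A k φ' y‖ ^ 2
      = siteInner ((fun y => if y ∈ Ωk then φ y else 0) - avgQkLin C A k φ')
          ((fun y => if y ∈ Ωk then φ y else 0) - avgQkLin C A k φ') := by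
  classical
  rw [siteInner_self_eq, ← Finset.mul_sum, ← Finset.sum_filter_add_sum_filter_not Finset.univ (· ∈ Ωk)]
  have h1 : Finset.univ.filter (· ∈ Ωk) = Ωk := by ext y; simp
  have h2 : ∑ y ∈ Finset.univ.filter (fun y => ¬ y ∈ Ωk),
      ‖((fun y => if y ∈ Ωk then φ y else 0) - avgQkLin C A k φ') y‖ ^ 2 = 0 := by
    refine Finset.sum_eq_zero fun y hy => ?_
    have hy' : y ∉ Ωk := (Finset.mem_filter.mp hy).2
    simp [hy', avgQkLin_apply_eq_zero_of_not_mem C A Ωk hφ' hy']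
  rw [h1, h2, add_zero]
  congr 1
  refine Finset.sum_congr rfl fun y hy => ?_
  simp [hy]

/-- **COMPLETING THE SQUARE** (the computation of *"calculating the integral in (2.19)"*, p. 610, for the typed B3 objects at
a GENERAL region `Ω = B^k(Ω^{(k)})` and background `B̃`; `msq > 0`, `a_k ≥ 0`): for every new field `φ` on `T^{(k)}` and every old
field `φ′` supported in `Ω`,
`a_k(L^kη)^{d−2}Σ_{y∈Ω^{(k)}}|φ(y) − (Q_k(B̃)φ′)(y)|² + ⟨φ′,(−Δ^{η,N}_{B̃,Ω} + msq)φ′⟩` (`−Δ^{η,N}_{B̃,Ω} + msq` =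
`HiggsCovariance.delta0`, (I.2.17))
` = [a_k(L^kη)^{−2}⟨1φ,1φ⟩ − a_k²(L^kη)^{−4}⟨Q_k^*1φ, G_k(Ω,B̃)Q_k^*1φ⟩] + ⟨φ′ − φ′₀, G_k(Ω,B̃)^{−1}(φ′ − φ′₀)⟩`
with the MEAN `φ′₀ = a_k(L^kη)^{−2}G_k(Ω,B̃)Q_k^*(B̃)1φ` and `1φ = 1_{Ω^{(k)}}φ`. [cite: Balaban1983Higgs3, §1 p.415] -/
theorem exponent_eq_completed_square (hmsq : 0 < msq) (hak : 0 ≤ B1.aSeq a P.L k) (φ : ScalarField P k N)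
    {φ' : ScalarField P 0 N} (hφ' : ∀ x, x ∉ region k Ωk → φ' x = 0) :
    prec (B1.aSeq a P.L k) (P.mesh k) P.d * ∑ y ∈ Ωk, ‖φ y - avgQkLin C A k φ' y‖ ^ 2
        + siteInner φ' (delta0 C (region k Ωk) A msq φ')
      = (coeff221 P a k * siteInner (fun y => if y ∈ Ωk then φ y else 0) (fun y => if y ∈ Ωk then φ y else 0)
          - coeff221 P a k ^ 2 * siteInner (avgQkAdj C A k fun y => if y ∈ Ωk then φ y else 0)
              (propagatorK C (region k Ωk) A msq a k (avgQkAdj C A k fun y => if y ∈ Ωk then φ y else 0)))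
        + siteInner
            (φ' - coeff221 P a k • propagatorK C (region k Ωk) A msq a k (avgQkAdj C A k fun y => if y ∈ Ωk then φ y else 0))
            (covOpK C (region k Ωk) A msq a k
              (φ' - coeff221 P a k •
                propagatorK C (region k Ωk) A msq a k (avgQkAdj C A k fun y => if y ∈ Ωk then φ y else 0))) := by
  set ψ : ScalarField P k N := fun y => if y ∈ Ωk then φ y else 0 with hψ
  set c := coeff221 P a k with hc
  set b : ScalarField P 0 N := c • avgQkAdj C A k ψ with hb
  set g : ScalarField P 0 N := propagatorK C (region k Ωk) A msq a k b with hg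
  -- (E1) the kernel term through the scalar products
  have hE1 : prec (B1.aSeq a P.L k) (P.mesh k) P.d * ∑ y ∈ Ωk, ‖φ y - avgQkLin C A k φ' y‖ ^ 2
      = c * (siteInner ψ ψ - 2 * siteInner φ' (avgQkAdj C A k ψ)
          + siteInner φ' (avgQkAdj C A k (avgQkLin C A k φ'))) := by
    rw [prec_eq_coeff221_mul, mul_assoc, mesh_pow_mul_sum_eq_siteInner C A Ωk φ hφ', ← hc]
    congr 1
    rw [siteInner_sub_right, siteInner_comm (ψ - _) ψ, siteInner_comm (ψ - _) (avgQkLin C A k φ'),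
      siteInner_sub_right, siteInner_sub_right, siteInner_avgQkLin, siteInner_avgQkLin,
      siteInner_comm ψ (avgQkLin C A k φ'), siteInner_avgQkLin]
    ring
  -- (E2) the operator `G_k^{-1} = (−Δ^N + msq) + c P_k`
  have hE2 : siteInner φ' (delta0 C (region k Ωk) A msq φ')
      + c * siteInner φ' (avgQkAdj C A k (avgQkLin C A k φ')) = siteInner φ' (covOpK C (region k Ωk) A msq a k φ') := by
    have hMeq : covOpK C (region k Ωk) A msq a k = delta0 C (region k Ωk) A msq + c • projPk C A k := rfl
    rw [hMeq, LinearMap.add_apply, siteInner_add_right, LinearMap.smul_apply, siteInner_smul_right]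
    rfl
  -- (E3) `G_k^{-1} g = b`, symmetry of `G_k^{-1}`, the square
  have hMg : covOpK C (region k Ωk) A msq a k g = b := by
    rw [hg, covOpK_propagatorK_apply C _ A hmsq a k hak]
  have hsym : siteInner g (covOpK C (region k Ωk) A msq a k φ') = siteInner φ' b := by
    rw [siteInner_covOpK_comm C _ A msq a k g φ', hMg]
  have hsq : siteInner (φ' - g) (covOpK C (region k Ωk) A msq a k (φ' - g))
      = siteInner φ' (covOpK C (region k Ωk) A msq a k φ') - 2 * siteInner φ' b + siteInner b g := by
    rw [map_sub, siteInner_sub_right, siteInner_comm (φ' - g) (covOpK C (region k Ωk) A msq a k φ'),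
      siteInner_comm (φ' - g) (covOpK C (region k Ωk) A msq a k g), siteInner_sub_right, siteInner_sub_right, hMg,
      siteInner_comm (covOpK C (region k Ωk) A msq a k φ') φ', siteInner_comm (covOpK C (region k Ωk) A msq a k φ') g,
      hsym, siteInner_comm b φ']
    ring
  have hgb : g = c • propagatorK C (region k Ωk) A msq a k (avgQkAdj C A k ψ) := by rw [hg, hb, map_smul]
  rw [hgb] at hsq
  rw [hsq, hE1, ← hE2, hb, siteInner_smul_right, siteInner_smul_left, siteInner_smul_right]
  ring

/-- **The constant is (I.2.21)**: for `k ≥ 1` the `φ`-dependent constant of the completed square is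
`⟨1φ, Δ^{(k)}(Ω,B̃) 1φ⟩` with p35's `B1Eq230FluctCov.deltaKA` (the solved form (2.21) for general `B̃`, `Ω`) — i.e. the
transformation of the Gaussian density yields `exp(−½⟨φ, Δ^{(k)}φ⟩)` on `Ω^{(k)}`, paper I (2.19) → (2.21) for the concrete
B3 objects. [cite: Balaban1982Higgs1, (2.21) p.610] -/
theorem const_eq_siteInner_deltaKA (j : ℕ) (ψ : ScalarField P (j + 1) N) (Ω : Finset (HiggsLattice.Site P 0)) :
    coeff221 P a (j + 1) * siteInner ψ ψ
        - coeff221 P a (j + 1) ^ 2 * siteInner (avgQkAdj C A (j + 1) ψ)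
            (propagatorK C Ω A msq a (j + 1) (avgQkAdj C A (j + 1) ψ))
      = siteInner ψ (deltaKA C Ω A msq a (j + 1) ψ) := by
  rw [siteInner_deltaKA_succ,
    siteInner_comm ψ (avgQkLin C A (j + 1) (propagatorK C Ω A msq a (j + 1) (avgQkAdj C A (j + 1) ψ))),
    siteInner_avgQkLin, siteInner_comm _ (avgQkAdj C A (j + 1) ψ)]

end Square

/-! ## 3. For the typed (1.4): the Gaussian weight `t(Ω;φ,φ′)·exp(−½⟨φ′,(−Δ^η_{B̃,Ω}+m²(L^kε)²)φ′⟩)` of `Data14` -/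

section Typed

variable {k : ℕ} (D : Data14 P N k)

/-- The operator of the quadratic form of (1.4) at `e′ = 0` is paper I's `Δ^{(0)}`-shaped `−Δ^{η,N}_{A^{(k)},Ω} + m²(L^kε)²`
(`HiggsCovariance.delta0` at the mass `m²(L^kε)²`; definitional). [cite: Balaban1983Higgs3, (1.4) p.412] -/
theorem scalarOp_zero_eq_delta0 (Ak : HiggsLattice.VecField P 0) (A' : (j : Fin k) → HiggsLattice.VecField P j) :
    D.scalarOp Ak 0 A' = delta0 D.C D.Ω Ak (D.m2 * D.ell ^ 2) := by
  rw [Data14.scalarOp_zero]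
  rfl

/-- **The MEAN `φ′₀ = a_k(L^kη)^{−2}G_k(Ω,B̃)Q_k^*(B̃)(1_{Ω^{(k)}}φ)` is supported in `Ω`** (`B̃ = A^{(k)}`, `m²(L^kε)² > 0`,
`a_k ≥ 0`): print's external scalar field lives on the region of the old fields. [cite: Balaban1983Higgs3, §1 p.415] -/
theorem mean_apply_of_not_mem (hm : 0 < D.m2 * D.ell ^ 2) (hak : 0 ≤ B1.aSeq D.a P.L k) (Ak : HiggsLattice.VecField P 0)
    (φ : ScalarField P k N) {x : HiggsLattice.Site P 0} (hx : x ∉ D.Ω) :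
    (coeff221 P D.a k • propagatorK D.C D.Ω Ak (D.m2 * D.ell ^ 2) D.a k
      (avgQkAdj D.C Ak k fun y => if y ∈ D.Ωk then φ y else 0)) x = 0 := by
  have hb : ∀ x', x' ∉ region k D.Ωk → (avgQkAdj D.C Ak k fun y => if y ∈ D.Ωk then φ y else 0) x' = 0 := by
    intro x' hx'
    rw [avgQkAdj_apply_eq, if_neg (by rwa [mem_region] at hx'), map_zero]
  have h := propagatorK_apply_of_not_mem D.C Ak D.Ωk (D.m2 * D.ell ^ 2) D.a hm hak hb hx
  rw [show region k D.Ωk = D.Ω from rfl] at h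
  rw [Pi.smul_apply, h, smul_zero]

/-- The mean, restricted to `Ω` and extended by zero, is the mean (it is a field «on `Ω`» in the sense of the typed
transformation `Data14.rt14`, which integrates over `φ′↾Ω`). [cite: Balaban1983Higgs3, §1 p.415] -/
theorem extendZero_mean (hm : 0 < D.m2 * D.ell ^ 2) (hak : 0 ≤ B1.aSeq D.a P.L k) (Ak : HiggsLattice.VecField P 0)
    (φ : ScalarField P k N) :
    extendZero D.Ω (fun x : ↥D.Ω =>
        (coeff221 P D.a k • propagatorK D.C D.Ω Ak (D.m2 * D.ell ^ 2) D.a k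
          (avgQkAdj D.C Ak k fun y => if y ∈ D.Ωk then φ y else 0)) x.1)
      = coeff221 P D.a k • propagatorK D.C D.Ω Ak (D.m2 * D.ell ^ 2) D.a k
          (avgQkAdj D.C Ak k fun y => if y ∈ D.Ωk then φ y else 0) := by
  funext x
  by_cases hx : x ∈ D.Ω
  · rw [extendZero_of_mem _ _ hx]
  · rw [extendZero_of_not_mem _ _ hx, mean_apply_of_not_mem D hm hak Ak φ hx]

/-- The kernel `t(Ω;φ,φ′)` of the typed (1.4) at `e′ = 0` collected into ONE exponential:
`t = ((a_k(L^kη)^{d−2}/2π)^{N/2})^{|Ω^{(k)}|} · exp(−½ a_k(L^kη)^{d−2} Σ_{y∈Ω^{(k)}} |φ(y) − (Q_k(A^{(k)})φ′)(y)|²)`, `φ′ = φ′↾Ω`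
extended by zero ((I.2.5)/(I.2.10)). [cite: Balaban1982Higgs1, (2.10) p.609] -/
theorem kernel14_zero_eq_exp (Ak : HiggsLattice.VecField P 0) (A' : (j : Fin k) → HiggsLattice.VecField P j)
    (φ : ScalarField P k N) (φΩ : ↥D.Ω → EuclideanSpace ℝ (Fin N)) :
    D.kernel14 Ak 0 A' φ φΩ
      = ((prec (B1.aSeq D.a P.L k) (P.mesh k) P.d / (2 * Real.pi)) ^ ((N : ℝ) / 2)) ^ D.Ωk.card
        * Real.exp (-(prec (B1.aSeq D.a P.L k) (P.mesh k) P.d / 2)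
            * ∑ y ∈ D.Ωk, ‖φ y - avgQkLin D.C Ak k (extendZero D.Ω φΩ) y‖ ^ 2) := by
  rw [Data14.kernel14_eq]
  simp only [Data14.avgQ14_zero, rtKernel_eq, ← avgQkLin_apply]
  rw [Finset.prod_mul_distrib, Finset.prod_const, Finset.card_univ, Fintype.card_coe, ← Real.exp_sum,
    ← Finset.mul_sum, finrank_euclideanSpace_fin,
    Finset.sum_coe_sort D.Ωk (fun y => ‖φ y - avgQkLin D.C Ak k (extendZero D.Ω φΩ) y‖ ^ 2)]

/-- **«The basic propagator for the scalar field φ′ is G_k(Ω, B̃)»; «The external scalar field is a_kG_k(Ω, B̃)Q_k(B̃)φ»**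
(pp. 414–415) FOR THE TYPED (1.4): at `e′ = 0` the Gaussian weight of the fibre integrand — the kernel `t(Ω;φ,φ′)` of
`Data14.kernel14` times the Gaussian factor `exp(−½⟨φ′,(−Δ^η_{A^{(k)},Ω} + m²(L^kε)²)φ′⟩)` of `Data14.density14` — IS
`((a_k(L^kη)^{d−2}/2π)^{N/2})^{|Ω^{(k)}|} · exp(−½⟨1φ, Δ^{(k)}(Ω,A^{(k)})1φ⟩) · exp(−½⟨φ′ − φ′₀, G_k(Ω,A^{(k)})^{−1}(φ′ − φ′₀)⟩)`:
a Gaussian in `φ′` with MEAN `φ′₀ = a_k(L^kη)^{−2}G_k(Ω,A^{(k)})Q_k^*(A^{(k)})(1_{Ω^{(k)}}φ)` and COVARIANCE operator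
`G_k(Ω,A^{(k)}) = (−Δ^{η,N}_{A^{(k)},Ω} + m²(L^kε)² + a_k(L^kη)^{−2}P_k(A^{(k)}))^{−1}` (`HiggsCovariance.propagatorK` at the mass
`m²(L^kε)²`), times the new-field Gaussian `exp(−½⟨φ,Δ^{(k)}φ⟩)` of (I.2.19)/(I.2.21) (`const_eq_siteInner_deltaKA`).
`m²(L^kε)² > 0`, `a_k ≥ 0`; every `A^{(k)}`, `φ`, `φ′↾Ω`. PROVED. [cite: Balaban1983Higgs3, §1 pp.414–415] -/
theorem kernel14_mul_exp_eq (hm : 0 < D.m2 * D.ell ^ 2) (hak : 0 ≤ B1.aSeq D.a P.L k) (Ak : HiggsLattice.VecField P 0)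
    (A' : (j : Fin k) → HiggsLattice.VecField P j) (φ : ScalarField P k N) (φΩ : ↥D.Ω → EuclideanSpace ℝ (Fin N)) :
    D.kernel14 Ak 0 A' φ φΩ
        * Real.exp (-(1 / 2 : ℝ) * siteInner (extendZero D.Ω φΩ) (D.scalarOp Ak 0 A' (extendZero D.Ω φΩ)))
      = ((prec (B1.aSeq D.a P.L k) (P.mesh k) P.d / (2 * Real.pi)) ^ ((N : ℝ) / 2)) ^ D.Ωk.card
        * Real.exp (-(1 / 2 : ℝ) *
            (coeff221 P D.a k * siteInner (fun y => if y ∈ D.Ωk then φ y else 0) (fun y => if y ∈ D.Ωk then φ y else 0)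
              - coeff221 P D.a k ^ 2 * siteInner (avgQkAdj D.C Ak k fun y => if y ∈ D.Ωk then φ y else 0)
                  (propagatorK D.C D.Ω Ak (D.m2 * D.ell ^ 2) D.a k
                    (avgQkAdj D.C Ak k fun y => if y ∈ D.Ωk then φ y else 0))))
        * Real.exp (-(1 / 2 : ℝ) *
            siteInner
              (extendZero D.Ω φΩ - coeff221 P D.a k • propagatorK D.C D.Ω Ak (D.m2 * D.ell ^ 2) D.a k
                (avgQkAdj D.C Ak k fun y => if y ∈ D.Ωk then φ y else 0))
              (covOpK D.C D.Ω Ak (D.m2 * D.ell ^ 2) D.a k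
                (extendZero D.Ω φΩ - coeff221 P D.a k • propagatorK D.C D.Ω Ak (D.m2 * D.ell ^ 2) D.a k
                  (avgQkAdj D.C Ak k fun y => if y ∈ D.Ωk then φ y else 0)))) := by
  have hsupp : ∀ x, x ∉ region k D.Ωk → extendZero D.Ω φΩ x = 0 := fun x hx => extendZero_of_not_mem _ _ hx
  have hsq := exponent_eq_completed_square D.C Ak D.Ωk (D.m2 * D.ell ^ 2) D.a hm hak φ hsupp
  rw [show region k D.Ωk = D.Ω from rfl] at hsq
  rw [kernel14_zero_eq_exp, scalarOp_zero_eq_delta0, mul_assoc, ← Real.exp_add, mul_assoc, ← Real.exp_add]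
  congr 1
  congr 1
  rw [← mul_add, ← hsq]
  ring

/-- `extendZero` is additive (fields on `Ω` extended by zero). [cite: Balaban1982Higgs1, (2.4) p.608] -/
theorem extendZero_add (Ω : Finset (HiggsLattice.Site P 0)) (f g : ↥Ω → EuclideanSpace ℝ (Fin N)) :
    extendZero Ω (f + g) = extendZero Ω f + extendZero Ω g := by
  funext x
  by_cases hx : x ∈ Ω
  · simp [extendZero, hx]
  · simp [extendZero, hx]

/-- **The renormalization transformation of (1.4) applied to the Gaussian density times an observable** — the form in
which print USES the two sentences (*"obtained from Gaussian integrals in (1.5)"*, p. 415): for every `F`,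
`T^η_{a_k,L^k,A^{(k)}}[Ω, e^{−½⟨φ′,(−Δ^η_{A^{(k)},Ω}+m²(L^kε)²)φ′⟩}F](φ)
 = ((a_k(L^kη)^{d−2}/2π)^{N/2})^{|Ω^{(k)}|} e^{−½⟨1φ,Δ^{(k)}(Ω,A^{(k)})1φ⟩} ∫dχ↾Ω e^{−½⟨χ, G_k(Ω,A^{(k)})^{−1}χ⟩} F(φ′₀ + χ)`:
after the translation `φ′ = φ′₀ + χ` by the mean (translation invariance of `∫dφ′↾Ω`), the old field is the centred Gaussian
fluctuation `χ` with covariance `G_k(Ω,A^{(k)})` around the external scalar field `φ′₀ = a_k(L^kη)^{−2}G_k(Ω,A^{(k)})Q_k^*(A^{(k)})(1φ)`.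
`m²(L^kε)² > 0`, `a_k ≥ 0`. PROVED. [cite: Balaban1983Higgs3, §1 pp.414–415] -/
theorem rt14_gaussian_eq (hm : 0 < D.m2 * D.ell ^ 2) (hak : 0 ≤ B1.aSeq D.a P.L k) (Ak : HiggsLattice.VecField P 0)
    (A' : (j : Fin k) → HiggsLattice.VecField P j) (φ : ScalarField P k N) (F : ScalarField P 0 N → ℝ) :
    D.rt14 Ak 0 A' (fun φ' => Real.exp (-(1 / 2 : ℝ) * siteInner φ' (D.scalarOp Ak 0 A' φ')) * F φ') φ
      = ((prec (B1.aSeq D.a P.L k) (P.mesh k) P.d / (2 * Real.pi)) ^ ((N : ℝ) / 2)) ^ D.Ωk.card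
        * Real.exp (-(1 / 2 : ℝ) *
            (coeff221 P D.a k * siteInner (fun y => if y ∈ D.Ωk then φ y else 0) (fun y => if y ∈ D.Ωk then φ y else 0)
              - coeff221 P D.a k ^ 2 * siteInner (avgQkAdj D.C Ak k fun y => if y ∈ D.Ωk then φ y else 0)
                  (propagatorK D.C D.Ω Ak (D.m2 * D.ell ^ 2) D.a k
                    (avgQkAdj D.C Ak k fun y => if y ∈ D.Ωk then φ y else 0))))
        * ∫ χΩ : ↥D.Ω → EuclideanSpace ℝ (Fin N),
            Real.exp (-(1 / 2 : ℝ) * siteInner (extendZero D.Ω χΩ)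
                (covOpK D.C D.Ω Ak (D.m2 * D.ell ^ 2) D.a k (extendZero D.Ω χΩ)))
              * F (coeff221 P D.a k • propagatorK D.C D.Ω Ak (D.m2 * D.ell ^ 2) D.a k
                    (avgQkAdj D.C Ak k fun y => if y ∈ D.Ωk then φ y else 0) + extendZero D.Ω χΩ) := by
  set φ₀ : ScalarField P 0 N := coeff221 P D.a k • propagatorK D.C D.Ω Ak (D.m2 * D.ell ^ 2) D.a k
    (avgQkAdj D.C Ak k fun y => if y ∈ D.Ωk then φ y else 0) with hφ₀
  set φ₀Ω : ↥D.Ω → EuclideanSpace ℝ (Fin N) := fun x => φ₀ x.1 with hφ₀Ω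
  have hext : extendZero D.Ω φ₀Ω = φ₀ := extendZero_mean D hm hak Ak φ
  rw [Data14.rt14_eq]
  have hpt : ∀ φΩ : ↥D.Ω → EuclideanSpace ℝ (Fin N),
      D.kernel14 Ak 0 A' φ φΩ
          * (Real.exp (-(1 / 2 : ℝ) * siteInner (extendZero D.Ω φΩ) (D.scalarOp Ak 0 A' (extendZero D.Ω φΩ)))
              * F (extendZero D.Ω φΩ))
        = ((prec (B1.aSeq D.a P.L k) (P.mesh k) P.d / (2 * Real.pi)) ^ ((N : ℝ) / 2)) ^ D.Ωk.card
          * Real.exp (-(1 / 2 : ℝ) *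
              (coeff221 P D.a k * siteInner (fun y => if y ∈ D.Ωk then φ y else 0) (fun y => if y ∈ D.Ωk then φ y else 0)
                - coeff221 P D.a k ^ 2 * siteInner (avgQkAdj D.C Ak k fun y => if y ∈ D.Ωk then φ y else 0)
                    (propagatorK D.C D.Ω Ak (D.m2 * D.ell ^ 2) D.a k
                      (avgQkAdj D.C Ak k fun y => if y ∈ D.Ωk then φ y else 0))))
          * (Real.exp (-(1 / 2 : ℝ) * siteInner (extendZero D.Ω φΩ - φ₀)
                (covOpK D.C D.Ω Ak (D.m2 * D.ell ^ 2) D.a k (extendZero D.Ω φΩ - φ₀)))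
              * F (extendZero D.Ω φΩ)) := by
    intro φΩ
    rw [← mul_assoc, kernel14_mul_exp_eq D hm hak Ak A' φ φΩ, mul_assoc]
  simp_rw [hpt]
  rw [integral_const_mul]
  congr 1
  rw [← integral_add_left_eq_self _ φ₀Ω]
  refine integral_congr_ae (Filter.Eventually.of_forall fun χΩ => ?_)
  simp only [extendZero_add, hext, add_sub_cancel_left]

end Typed

end Literature.MathematicalPhysics.QuantumFieldTheory.Balaban1983to89.B3ScalarPropagatorMean
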